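import Literature.NumberTheory.Automorphic.CongruenceSubgroupPropertySL2Mennicke
import Literature.NumberTheory.Automorphic.CongruenceSubgroupPropertySL2AwayArith
import Literature.NumberTheory.Automorphic.SL2AwayRelativeElementary
import Mathlib.NumberTheory.LegendreSymbol.QuadraticReciprocity
import Mathlib.NumberTheory.LSeries.PrimesInAP
import HarnessLib

/-!
# Serre's congruence subgroup property for `SL₂(ℤ[1/m])` — proofs: Mennicke symbols on `W_𝔮(ℤ[1/m])`
# are trivial (Bass–Milnor–Serre, Ch. I Thm. 3.6 with Thm. 3.5 Case 1, over `ℚ`)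

Topic `Literature/NumberTheory/Automorphic`; namespace `Literature.NumberTheory.Automorphic`
(sub-namespace `SerreSL2.MennickeSymbol`).  Everything here is PROVED; no definitions, no named facts.

This is the `A = ℤ[1/m]` (`= Localization.Away (m : ℤ)`, `m ≥ 2`) counterpart of
`CongruenceSubgroupPropertySL2MennickeTrivial.lean` (there `A = 𝓞_K`, via Hilbert reciprocity over `K`):

* `SerreSL2.MennickeSymbol.sym_sq_eq_one_away` — **BMS Thm. 3.6 (i)–(ii)**: every value `[b over a]`,
  `(a, b) ∈ W_{(q)}`, of a Mennicke symbol over `ℤ[1/m]` has order dividing `2` (the tree's argument verbatim,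
  with Serre's Lemme 3 for `ℤ[1/m]`, `SerreSL2.Away.exists_add_mul_forall_not_dvd_orderOf`);
* `SerreSL2.MennickeSymbol.sym_eq_one_away` — **BMS Thm. 3.6**: every Mennicke symbol on `W_{(q)}` over
  `ℤ[1/m]` is TRIVIAL.  Proof = Thm. 3.5, Case 1 over `ℚ`, with Hilbert reciprocity replaced by Mathlib's
  quadratic reciprocity for Legendre symbols and the ray-class Dirichlet theorem by Dirichlet's theorem on primes
  in arithmetic progressions (`Nat.forall_exists_prime_gt_and_zmodEq`): given `(a, b'q) ∈ W_{(q)}`,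
  (1) move `a` to a rational prime `P₀ ≡ a (mod b'q)`, `P₀ ∤ 2m` (MS1);
  (2) move `b'` to `b₁ = -L`, `L ≡ -b' (mod P₀)` a rational prime with `L ≡ 3 (mod 4)` (Lemma 2.7 (c));
  (3) move `P₀` to `a₁ = εP`, `P ≡ εP₀ (mod L·Q)` a rational prime, `(q) = (Q)`, where `ε = (P₀ | L)` (MS1);
  (4) quadratic reciprocity: `(-L | P) = (P | L) = (εP₀ | L) = ε² = 1`, so `-L ≡ c² (mod P)`;
  (5) `[b₁q over a₁] = [c²q over a₁] = [cq over a₁]² = 1` (Lemma 2.7 (c), 2.9 (a), `sym_sq_eq_one_away`).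
  The auxiliary `legendreSym_neg_eq_one` is step (4); `exists_prime_three_mod_four` is the Dirichlet/CRT step (2).

Consumed by the `ℤ[1/m]` port of Vaserstein's theorem (`G((q), A) ≤ E((q), A)`, cell bsd-print-x8 ty2, files
`CongruenceSubgroupPropertySL2Away*.lean`), which discharges `SerreSL2Congruence1970_congruenceSubgroupProperty_away`
and stub 1a of LINE `theoremB-x10b` (crux `PrintX10b.AnalyticMuZeroX10b`, cell bsd-f3-mu).

## References

* [BassMilnorSerre1967] H. Bass, J. Milnor, J.-P. Serre, Publ. Math. IHES 33 (1967), Ch. I, Def. 2.5, Lemmas 2.7, 2.9,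
  Thm. 3.2, Thm. 3.5 (Case 1), Thm. 3.6.
* [SerreSL2Congruence1970] J.-P. Serre, Ann. of Math. 92 (1970), §2.2 Lemme 3, §2.6.
-/

open IsDedekindDomain

namespace Literature.NumberTheory.Automorphic

namespace SerreSL2

namespace MennickeSymbol

/-! ### Step (4): the quadratic-reciprocity computation over `ℚ` -/

/-- For odd primes `L ≠ P` with `L ≡ 3 (mod 4)` and `P ≡ ε x (mod L)`, where `ε = (x | L)` and `L ∤ x`:
`-L` is a square modulo `P`, i.e. `(-L | P) = 1` — quadratic reciprocity:
`(-L | P) = (-1 | P)(L | P) = (-1 | P)² (P | L) = (ε x | L) = ε · ε = 1` (as `(-1 | L) = -1`).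
[cite: BassMilnorSerre1967, Ch. I Thm. 3.5 (Case 1, the reciprocity step (A.21))] -/
theorem legendreSym_neg_eq_one {L P : ℕ} [Fact L.Prime] [Fact P.Prime] (hL2 : L ≠ 2) (hP2 : P ≠ 2)
    (hL4 : L % 4 = 3) {x : ℤ} (hx : (x : ZMod L) ≠ 0)
    (hP : ((P : ℤ) : ZMod L) = ((legendreSym L x * x : ℤ) : ZMod L)) :
    legendreSym P (-(L : ℤ)) = 1 := by
  have hPodd : P % 2 = 1 := Nat.odd_iff.mp ((Fact.out : P.Prime).eq_two_or_odd'.resolve_left hP2)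
  -- `χ₄(P)² = 1`
  have hχP : ZMod.χ₄ (P : ℕ) * ZMod.χ₄ (P : ℕ) = 1 := by
    have h := ZMod.χ₄_nat_eq_if_mod_four P
    simp only [hPodd, one_ne_zero, if_false] at h
    split_ifs at h <;> rw [h] <;> norm_num
  -- reciprocity: `(L | P) = (-1)^{(L-1)/2 · (P-1)/2} (P | L) = χ₄(P) (P | L)` as `L ≡ 3 (mod 4)`
  have hrec : legendreSym P (L : ℤ) = (-1) ^ (L / 2 * (P / 2)) * legendreSym L (P : ℤ) :=
    legendreSym.quadratic_reciprocity' hL2 hP2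
  have hsign : ((-1 : ℤ)) ^ (L / 2 * (P / 2)) = ZMod.χ₄ (P : ℕ) := by
    rw [pow_mul, ZMod.neg_one_pow_div_two_of_three_mod_four hL4, ZMod.χ₄_eq_neg_one_pow hPodd]
  have hneg : legendreSym P (-1) = ZMod.χ₄ (P : ℕ) := legendreSym.at_neg_one hP2
  -- `(P | L) = (ε x | L)` since `P ≡ ε x (mod L)`, and `(ε x | L) = (ε | L)(x | L) = 1`
  have hLP : legendreSym L (P : ℤ) = legendreSym L (legendreSym L x * x) := by
    rw [legendreSym.mod L (P : ℤ), legendreSym.mod L (legendreSym L x * x)]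
    congr 1
    exact (ZMod.intCast_eq_intCast_iff' _ _ _).mp hP
  have hεx : legendreSym L (legendreSym L x * x) = 1 := by
    rcases legendreSym.eq_one_or_neg_one L hx with h | h
    · rw [h, one_mul, h]
    · rw [h, legendreSym.mul, h, legendreSym.at_neg_one hL2, ZMod.χ₄_nat_three_mod_four hL4]
      norm_num
  calc legendreSym P (-(L : ℤ)) = legendreSym P (-1) * legendreSym P (L : ℤ) := by
        rw [← legendreSym.mul]; ring_nf
    _ = ZMod.χ₄ (P : ℕ) * (ZMod.χ₄ (P : ℕ) * legendreSym L (P : ℤ)) := by rw [hneg, hrec, hsign]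
    _ = legendreSym L (P : ℤ) := by rw [← mul_assoc, hχP, one_mul]
    _ = 1 := by rw [hLP, hεx]

/-! ### Step (2): a prime `L ≡ 3 (mod 4)` in a prescribed class modulo an odd prime -/

/-- For an odd prime `P₀` and an integer `z` prime to `P₀` there are arbitrarily large rational primes
`L ≡ 3 (mod 4)` with `L ≡ -z (mod P₀)` (Chinese remainder + Dirichlet's theorem on primes in arithmetic progressions,
the `K = ℚ` case of Bass–Milnor–Serre's (A.10)–(A.11)). [cite: BassMilnorSerre1967, Appendix (A.10)–(A.11)] -/
theorem exists_prime_three_mod_four {P₀ : ℕ} (hP₀ : P₀.Prime) (hP₀2 : P₀ ≠ 2) {z : ℤ}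
    (hz : IsCoprime z P₀) (n : ℕ) :
    ∃ L : ℕ, n < L ∧ L.Prime ∧ L % 4 = 3 ∧ (P₀ : ℤ) ∣ L + z := by
  have hodd : P₀ % 2 = 1 := Nat.odd_iff.mp (hP₀.eq_two_or_odd'.resolve_left hP₀2)
  -- `w ≡ -z (mod P₀)`, `w ≡ 3 (mod 4)`
  set w : ℤ := -z + P₀ * (P₀ * (3 + z)) with hw
  have hP₀sq : (4 : ℤ) ∣ (P₀ : ℤ) * P₀ - 1 := by
    obtain ⟨k, hk⟩ : ∃ k : ℤ, (P₀ : ℤ) = 2 * k + 1 := ⟨(P₀ : ℤ) / 2, by omega⟩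
    exact ⟨k * (k + 1), by rw [hk]; ring⟩
  obtain ⟨c, hc⟩ := hP₀sq
  have hwc : w = 3 + 4 * (c * (3 + z)) := by
    rw [hw]; linear_combination (3 + z) * hc
  have hw4 : w % 4 = 3 := by rw [hwc]; omega
  have hwcop : IsCoprime w ((4 * P₀ : ℕ) : ℤ) := by
    push_cast
    refine IsCoprime.mul_right ?_ ?_
    · -- `w` is odd, hence prime to `4 = 2 · 2`
      have h2 : IsCoprime w 2 := by
        have e : w = 1 + 2 * (1 + 2 * (c * (3 + z))) := by rw [hwc]; ring
        rw [e]
        exact isCoprime_one_left.add_mul_left_left _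
      have : (4 : ℤ) = 2 * 2 := by norm_num
      rw [this]
      exact h2.mul_right h2
    · rw [hw]
      exact hz.neg_left.add_mul_left_left _
  obtain ⟨L, hLn, hL, hLw⟩ := Nat.forall_exists_prime_gt_and_zmodEq n (q := 4 * P₀) (a := w)
    (mul_ne_zero (by norm_num) hP₀.ne_zero) hwcop
  push_cast at hLw
  refine ⟨L, hLn, hL, ?_, ?_⟩
  · have h4 : (L : ℤ) ≡ w [ZMOD 4] := hLw.of_mul_right _
    unfold Int.ModEq at h4
    rw [hw4] at h4
    omega
  · have hP : (L : ℤ) ≡ w [ZMOD P₀] := hLw.of_mul_left _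
    have hdvd : (P₀ : ℤ) ∣ (L : ℤ) - w := (Int.ModEq.dvd hP.symm)
    have e : (L : ℤ) + z = ((L : ℤ) - w) + P₀ * (P₀ * (3 + z)) := by rw [hw]; ring
    rw [e]
    exact dvd_add hdvd (dvd_mul_right _ _)

/-! ### BMS Thm. 3.6 (i)–(ii) over `ℤ[1/m]`: every symbol value has order dividing `2` -/

section Away

variable {m : ℕ} {q : Localization.Away (m : ℤ)} {C : Type*} [Group C]
  (M : MennickeSymbol (Ideal.span {q}) C)

/-- **BMS Thm. 3.6, steps (i)–(ii), for `A = ℤ[1/m]`** (`ℚ` has a real place, `m(A) = 2`): every value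
`[b over a]`, `(a, b) ∈ W_{(q)}`, of a Mennicke symbol satisfies `[b over a]² = 1`.  For each prime `l`, Serre's
Lemme 3 for `ℤ[1/m]` (`SerreSL2.Away.exists_add_mul_forall_not_dvd_orderOf`) moves `a` inside its class modulo
`b` to `a₁` with `U(A/a₁A)` free of elements of order divisible by `l^{v_l(2)+1}`; as `[b over a] = [b over a₁]`
has order dividing that of `b/q` in `U(A/a₁A)`, its order divides `2`. [cite: BassMilnorSerre1967, Ch. I Thm. 3.6 (ii)] -/
theorem sym_sq_eq_one_away (hm : m ≠ 0) {a b : Localization.Away (m : ℤ)} (ha : a - 1 ∈ Ideal.span {q})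
    (hb : b ∈ Ideal.span {q}) (hab : IsCoprime a b) : M.sym a b ^ 2 = 1 := by
  classical
  obtain ⟨b', rfl⟩ := Ideal.mem_span_singleton'.mp hb
  by_cases hb0 : b' * q = 0
  · rw [hb0] at hab ⊢
    have hau : IsUnit a := isCoprime_zero_right.mp hab
    rw [M.sym_eq_one_of_eq_unit_add (-1) hau.unit ha (Ideal.zero_mem _) hab
      (by rw [IsUnit.unit_spec]; ring), one_pow]
  have key : ∀ l : ℕ, l.Prime → ∃ n : ℕ, 0 < n ∧ M.sym a (b' * q) ^ n = 1 ∧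
      ¬ l ^ (padicValNat l 2 + 1) ∣ n := by
    intro l hl
    obtain ⟨t, ht0, ht⟩ := SerreSL2.Away.exists_add_mul_forall_not_dvd_orderOf hm hab hb0 hl
    set a₁ := a + t * (b' * q) with ha₁
    have ha₁q : a₁ - 1 ∈ Ideal.span {q} := by
      have : a₁ - 1 = (a - 1) + t * b' * q := by rw [ha₁]; ring
      rw [this]
      exact Ideal.add_mem _ ha (Ideal.mul_mem_left _ _ (Ideal.mem_span_singleton_self q))
    have hab₁ : IsCoprime a₁ b' := by
      have : IsCoprime a₁ (b' * q) := by rw [ha₁]; exact hab.add_mul_right_left t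
      exact this.of_mul_right_left
    have hsym : M.sym a (b' * q) = M.sym a₁ (b' * q) := (M.ms1_left t ha hb hab).symm
    haveI : Finite (Localization.Away (m : ℤ) ⧸ Ideal.span {a₁}) :=
      SerreSL2.Away.finite_quotient_of_ne_bot hm (by rw [Ne, Ideal.span_singleton_eq_bot]; exact ht0)
    obtain ⟨u, -, hu⟩ := M.exists_pow_eq_one_of_units ha₁q hab₁
    exact ⟨orderOf u, orderOf_pos u, by rw [hsym, hu], ht u⟩
  set x := M.sym a (b' * q) with hx
  have hd : orderOf x ∣ 2 := by
    obtain ⟨n₂, hn₂, hx₂, -⟩ := key 2 Nat.prime_two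
    have hdpos : 0 < orderOf x := orderOf_pos_iff.mpr (isOfFinOrder_iff_pow_eq_one.mpr ⟨n₂, hn₂, hx₂⟩)
    rw [← Nat.factorization_le_iff_dvd hdpos.ne' two_ne_zero]
    intro l
    by_cases hl : l.Prime
    · obtain ⟨n, hn, hxn, hndvd⟩ := key l hl
      have h1 : (orderOf x).factorization l ≤ n.factorization l :=
        (Nat.factorization_le_iff_dvd hdpos.ne' hn.ne').mpr (orderOf_dvd_of_pow_eq_one hxn) l
      have h2 : n.factorization l < padicValNat l 2 + 1 := by
        rw [← not_le, ← hl.pow_dvd_iff_le_factorization hn.ne']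
        exact hndvd
      rw [Nat.factorization_def 2 hl]
      omega
    · simp [Nat.factorization_eq_zero_of_not_prime _ hl]
  exact orderOf_dvd_iff_pow_eq_one.mp hd

/-! ### BMS Thm. 3.6 over `ℤ[1/m]`: every Mennicke symbol on `W_{(q)}` is trivial -/

/-- An integer multiple of `P` in `ℤ` lies in the ideal `(P)` of `ℤ[1/m]` (`ℤ → ℤ[1/m]`). [cite: SerreSL2Congruence1970, §1.2] -/
theorem intCast_mem_span_of_dvd {P : ℕ} {z : ℤ} (h : (P : ℤ) ∣ z) :
    (z : Localization.Away (m : ℤ)) ∈ Ideal.span {((P : ℕ) : Localization.Away (m : ℤ))} := by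
  obtain ⟨k, rfl⟩ := h
  rw [Int.cast_mul, Int.cast_natCast]
  exact Ideal.mul_mem_right _ _ (Ideal.mem_span_singleton_self _)

/-- **Bass–Milnor–Serre, Ch. I Thm. 3.6 (with Thm. 3.5, Case 1) for `A = ℤ[1/m]`, `m ≥ 2`, `𝔮 = (q)`: every
Mennicke symbol on `W_𝔮` is trivial**, `[b over a] = 1` for all `(a, b) ∈ W_𝔮`.  See the module docstring for the
five steps (Dirichlet + quadratic reciprocity over `ℚ`). [cite: BassMilnorSerre1967, Ch. I Thm. 3.5 (Case 1) and Thm. 3.6] -/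
theorem sym_eq_one_away (hm2 : 2 ≤ m) {a b : Localization.Away (m : ℤ)} (ha : a - 1 ∈ Ideal.span {q})
    (hb : b ∈ Ideal.span {q}) (hab : IsCoprime a b) : M.sym a b = 1 := by
  classical
  have hm : m ≠ 0 := by omega
  haveI := SL2Rel.isDomain_away hm
  obtain ⟨b', rfl⟩ := Ideal.mem_span_singleton'.mp hb
  -- trivial case: `b' q` a unit (in particular `b = 0` forces `a` to be a unit, covered separately)
  by_cases hb0 : b' * q = 0
  · rw [hb0] at hab ⊢
    have hau : IsUnit a := isCoprime_zero_right.mp hab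
    exact M.sym_eq_one_of_eq_unit_add (-1) hau.unit ha (Ideal.zero_mem _) hab
      (by rw [IsUnit.unit_spec]; ring)
  by_cases hbu : IsUnit (b' * q)
  · exact M.sym_eq_one_of_eq_unit_add 0 hbu.unit ha hb hab (by simp)
  have hq0 : q ≠ 0 := right_ne_zero_of_mul hb0
  have hqmem : q ∈ Ideal.span {q} := Ideal.mem_span_singleton_self q
  have hmulq : ∀ c : Localization.Away (m : ℤ), c * q ∈ Ideal.span {q} := fun c ↦ Ideal.mul_mem_left _ c hqmem
  -- the integers `Qb`, `Q` with `(b' q) = (Qb)`, `(q) = (Q)`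
  obtain ⟨Qb, hQb, hQbm, hQbspan⟩ := SerreSL2.Away.exists_coprime_eq_span hm
    (J := Ideal.span {b' * q}) (by rwa [Ne, Ideal.span_singleton_eq_bot])
  obtain ⟨Q, hQ, hQm, hQspan⟩ := SerreSL2.Away.exists_coprime_eq_span hm
    (J := Ideal.span {q}) (by rwa [Ne, Ideal.span_singleton_eq_bot])
  -- Step 1: `a' = P₀` a rational prime `≡ a (mod b'q)`, `P₀ > m`, `P₀ > 2`
  have haQb : IsCoprime a ((Qb : ℕ) : Localization.Away (m : ℤ)) :=
    SerreSL2.Away.isCoprime_of_span_singleton_eq hab hQbspan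
  obtain ⟨P₀, hP₀gt, hP₀, hP₀a⟩ := SerreSL2.Away.exists_prime_natCast_sub_mem hm hQb hQbm haQb (m + 2)
  have hP₀m : ¬ P₀ ∣ m := SerreSL2.Away.not_dvd_of_lt hm (by omega)
  have hP₀2 : P₀ ≠ 2 := by omega
  haveI : Fact P₀.Prime := ⟨hP₀⟩
  have hP₀a' : ((P₀ : ℕ) : Localization.Away (m : ℤ)) - a ∈ Ideal.span {b' * q} := by rwa [hQbspan]
  obtain ⟨t, ht⟩ := Ideal.mem_span_singleton'.1 hP₀a'
  set a' : Localization.Away (m : ℤ) := ((P₀ : ℕ) : Localization.Away (m : ℤ)) with ha'def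
  have ha't : a' = a + t * (b' * q) := by rw [ha'def]; linear_combination -ht
  have ha' : a' - 1 ∈ Ideal.span {q} := by
    rw [ha't, show a + t * (b' * q) - 1 = (a - 1) + (t * b') * q by ring]
    exact Ideal.add_mem _ ha (hmulq _)
  have ha'b : IsCoprime a' (b' * q) := by rw [ha't]; exact hab.add_mul_right_left t
  have ha'b' : IsCoprime a' b' := ha'b.of_mul_right_left
  have e1 : M.sym a (b' * q) = M.sym a' (b' * q) := by rw [ha't]; exact (M.ms1_left t ha hb hab).symm
  -- Step 2: `b₁ = -L`, `L ≡ -b' (mod P₀)` a rational prime, `L ≡ 3 (mod 4)`, `L > P₀`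
  have hP₀cop : P₀.Coprime m := (Nat.Prime.coprime_iff_not_dvd hP₀).2 hP₀m
  obtain ⟨z, hz⟩ := SerreSL2.Away.exists_intCast_sub_mem hP₀cop b'
  have hzP₀ : IsCoprime z (P₀ : ℤ) :=
    SerreSL2.Away.isCoprime_int_of_sub_mem hm hP₀cop hz ha'b'.symm
  obtain ⟨L, hLgt, hL, hL4, hLz⟩ := exists_prime_three_mod_four hP₀ hP₀2 hzP₀ (m + P₀ + 2)
  haveI : Fact L.Prime := ⟨hL⟩
  have hL2 : L ≠ 2 := by omega
  have hLP₀ : L ≠ P₀ := by omega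
  set b₁ : Localization.Away (m : ℤ) := -((L : ℕ) : Localization.Away (m : ℤ)) with hb₁def
  have hb₁b' : b₁ - b' ∈ Ideal.span {a'} := by
    have e : b₁ - b' = -(((L : ℤ) + z : ℤ) : Localization.Away (m : ℤ)) + -(b' - z) := by
      rw [hb₁def]; push_cast; ring
    rw [e]
    exact Ideal.add_mem _ (Submodule.neg_mem _ (intCast_mem_span_of_dvd hLz)) (Submodule.neg_mem _ hz)
  have e2 : M.sym a' (b' * q) = M.sym a' (b₁ * q) := (M.sym_mul_q_eq_of_sub_mem ha' ha'b' hb₁b').symm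
  have ha'b₁ : IsCoprime a' b₁ := by
    obtain ⟨s, hs⟩ := Ideal.mem_span_singleton'.1 hb₁b'
    have e : b₁ = b' + s * a' := by rw [hs]; ring
    rw [e]; exact ha'b'.add_mul_right_right s
  have ha'b₁q : IsCoprime a' (b₁ * q) := isCoprime_mul_q ha' ha'b₁
  -- Step 3: `a₁ = ε P`, `P ≡ ε P₀ (mod L Q)` a rational prime, `ε = (P₀ | L)`
  have hP₀L : ((P₀ : ℤ) : ZMod L) ≠ 0 := by
    rw [Ne, ZMod.intCast_zmod_eq_zero_iff_dvd, Int.natCast_dvd_natCast]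
    intro h
    exact hLP₀ ((Nat.prime_dvd_prime_iff_eq hL hP₀).mp h)
  set ε : ℤ := legendreSym L (P₀ : ℤ) with hεdef
  have hε : ε = 1 ∨ ε = -1 := legendreSym.eq_one_or_neg_one L hP₀L
  have hεsq : ε * ε = 1 := by rcases hε with h | h <;> rw [h] <;> norm_num
  -- `Q ∣ P₀ - 1` (as `P₀ ≡ 1 (mod q)` and `(q) = (Q)`), so `ε P₀` is prime to `L Q`
  have hQP₀ : (Q : ℤ) ∣ (P₀ : ℤ) - 1 := by
    have h1 : (((P₀ : ℤ) - 1 : ℤ) : Localization.Away (m : ℤ)) ∈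
        Ideal.span {((Q : ℕ) : Localization.Away (m : ℤ))} := by
      rw [← hQspan]; push_cast; exact ha'
    exact SerreSL2.Away.natCast_dvd_of_intCast_mem_span hm hQm h1
  have hcopLQ : IsCoprime (ε * P₀) ((L * Q : ℕ) : ℤ) := by
    push_cast
    have hεu : IsCoprime ε ((L : ℤ) * Q) := by
      rcases hε with h | h
      · rw [h]; exact isCoprime_one_left
      · rw [h]; exact isCoprime_one_left.neg_left
    refine hεu.mul_left (IsCoprime.mul_right ?_ ?_)
    · rw [Nat.isCoprime_iff_coprime]; exact (Nat.coprime_primes hP₀ hL).mpr hLP₀.symm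
    · obtain ⟨k, hk⟩ := hQP₀
      exact ⟨1, -k, by linear_combination hk⟩
  obtain ⟨P, hPgt, hP, hPε⟩ := Nat.forall_exists_prime_gt_and_zmodEq (m + L + 2) (q := L * Q)
    (a := ε * P₀) (mul_ne_zero hL.ne_zero hQ.ne') hcopLQ
  haveI : Fact P.Prime := ⟨hP⟩
  have hPm : ¬ P ∣ m := SerreSL2.Away.not_dvd_of_lt hm (by omega)
  have hP2 : P ≠ 2 := by omega
  have hPL : L ≠ P := by omega
  push_cast at hPε
  -- `a₁ = ε P ≡ P₀ (mod L Q)`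
  set a₁ : Localization.Away (m : ℤ) := ((ε * P : ℤ) : Localization.Away (m : ℤ)) with ha₁def
  have hLQ : ((L : ℤ) * Q : ℤ) ∣ ε * P - P₀ := by
    have h1 : ε * (P : ℤ) ≡ ε * (ε * P₀) [ZMOD (L : ℤ) * Q] := hPε.mul_left ε
    rw [← mul_assoc, hεsq, one_mul] at h1
    exact (Int.ModEq.dvd h1.symm)
  have ha₁a' : a₁ - a' ∈ Ideal.span {b₁ * q} := by
    -- `Q = v q`, `ε P - P₀ = L Q k`, so `a₁ - a' = (b₁ q) · (-(v k))`
    obtain ⟨v, hv⟩ : ∃ v : Localization.Away (m : ℤ), v * q = ((Q : ℕ) : Localization.Away (m : ℤ)) :=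
      Ideal.mem_span_singleton'.1 (hQspan ▸ Ideal.mem_span_singleton_self _ :
        ((Q : ℕ) : Localization.Away (m : ℤ)) ∈ Ideal.span {q})
    obtain ⟨k, hk⟩ := hLQ
    have hcast := congrArg (fun w : ℤ ↦ (w : Localization.Away (m : ℤ))) hk
    simp only [Int.cast_sub, Int.cast_mul, Int.cast_natCast] at hcast
    refine Ideal.mem_span_singleton'.2 ⟨-(v * (k : Localization.Away (m : ℤ))), ?_⟩
    rw [ha₁def, ha'def, hb₁def]
    push_cast
    rw [hcast, ← hv]
    ring
  obtain ⟨t₁, ht₁⟩ := Ideal.mem_span_singleton'.1 ha₁a'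
  have ha₁t : a₁ = a' + t₁ * (b₁ * q) := by linear_combination -ht₁
  have ha₁ : a₁ - 1 ∈ Ideal.span {q} := by
    rw [ha₁t, show a' + t₁ * (b₁ * q) - 1 = (a' - 1) + (t₁ * b₁) * q by ring]
    exact Ideal.add_mem _ ha' (hmulq _)
  have ha₁b₁q : IsCoprime a₁ (b₁ * q) := by rw [ha₁t]; exact ha'b₁q.add_mul_right_left t₁
  have ha₁b₁ : IsCoprime a₁ b₁ := ha₁b₁q.of_mul_right_left
  have e3 : M.sym a' (b₁ * q) = M.sym a₁ (b₁ * q) := by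
    rw [ha₁t]; exact (M.ms1_left t₁ ha' (hmulq b₁) ha'b₁q).symm
  -- Step 4: quadratic reciprocity — `-L` is a square modulo `P`
  have hPmodL : ((P : ℤ) : ZMod L) = ((legendreSym L (P₀ : ℤ) * (P₀ : ℤ) : ℤ) : ZMod L) := by
    rw [← hεdef]
    exact (ZMod.intCast_eq_intCast_iff _ _ _).2 (hPε.of_mul_right _)
  have hleg : legendreSym P (-(L : ℤ)) = 1 := legendreSym_neg_eq_one hL2 hP2 hL4 hP₀L hPmodL
  have hL0P : ((-(L : ℤ) : ℤ) : ZMod P) ≠ 0 := by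
    rw [Int.cast_neg, Ne, neg_eq_zero, ZMod.intCast_zmod_eq_zero_iff_dvd, Int.natCast_dvd_natCast]
    intro h
    exact hPL ((Nat.prime_dvd_prime_iff_eq hP hL).mp h).symm
  obtain ⟨c, hc⟩ := (legendreSym.eq_one_iff P hL0P).mp hleg
  -- an integer square root `c₀` of `-L` modulo `P`
  set c₀ : ℤ := (c.val : ℤ) with hc₀
  have hc₀P : (P : ℤ) ∣ c₀ * c₀ + L := by
    rw [← ZMod.intCast_zmod_eq_zero_iff_dvd]
    push_cast
    rw [hc₀]
    push_cast
    rw [ZMod.natCast_zmod_val, ← hc]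
    push_cast; ring
  -- `c₀² ≡ b₁ (mod a₁)` in `ℤ[1/m]`
  have hspan_a₁ : Ideal.span {a₁} = Ideal.span {((P : ℕ) : Localization.Away (m : ℤ))} := by
    rw [ha₁def]; push_cast
    refine Ideal.span_singleton_mul_left_unit ?_ _
    rcases hε with h | h
    · rw [h]; push_cast; exact isUnit_one
    · rw [h]; push_cast; exact (isUnit_one (M := Localization.Away (m : ℤ))).neg
  have hcb₁ : (c₀ : Localization.Away (m : ℤ)) * c₀ - b₁ ∈ Ideal.span {a₁} := by
    rw [hspan_a₁, hb₁def, sub_neg_eq_add]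
    have := intCast_mem_span_of_dvd (m := m) hc₀P
    push_cast at this
    exact this
  have ha₁c : IsCoprime a₁ (c₀ : Localization.Away (m : ℤ)) := by
    obtain ⟨s, hs⟩ := Ideal.mem_span_singleton'.1 hcb₁
    have e : (c₀ : Localization.Away (m : ℤ)) * c₀ = b₁ + s * a₁ := by linear_combination -hs
    have h2 : IsCoprime a₁ ((c₀ : Localization.Away (m : ℤ)) * c₀) := by
      rw [e]; exact ha₁b₁.add_mul_right_right s
    exact h2.of_mul_right_left
  -- Step 5: `[b₁ q over a₁] = [c₀² q over a₁] = [c₀ q over a₁]² = 1`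
  have e4 : M.sym a₁ (b₁ * q) = M.sym a₁ ((c₀ : Localization.Away (m : ℤ)) * c₀ * q) :=
    (M.sym_mul_q_eq_of_sub_mem ha₁ ha₁b₁ hcb₁).symm
  have e5 : M.sym a₁ ((c₀ : Localization.Away (m : ℤ)) * c₀ * q) =
      M.sym a₁ ((c₀ : Localization.Away (m : ℤ)) * q) ^ 2 := by
    rw [M.sym_mul_q_pow ha₁ ha₁c 2, pow_two]
  have e6 : M.sym a₁ ((c₀ : Localization.Away (m : ℤ)) * q) ^ 2 = 1 :=
    M.sym_sq_eq_one_away hm ha₁ (hmulq _) (isCoprime_mul_q ha₁ ha₁c)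
  rw [e1, e2, e3, e4, e5, e6]

end Away

end MennickeSymbol

end SerreSL2

end Literature.NumberTheory.Automorphic
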